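import Summits.BirchSwinnertonDyer.BirchSwinnertonDyer.Theorems.EisensteinPrimesLcongrIffUnitCongruence
import Summits.BirchSwinnertonDyer.BirchSwinnertonDyer.Theorems.EisensteinPrimesLcongrAtLevelOne
import HarnessLib

/-!
# The SECOND level of the single-level door's `lcongr` is decided by the first-order term: if
# `L_g = u·L_E + p·M` with `u` a unit and `μ(L_E) = 0`, then `(L_g) + (p)² = (L_E) + (p)²` holds
# if and only if `M mod p` is a multiple of `L_E mod p` in `𝔽_p⟦T⟧` — so it FAILS as soon as
# `ord_T(M mod p) < λ(L_E)` (cell `bsd-eis`, seat `bsd-eis-cgshw` g21; route `EisensteinPrimes`,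
# crux 4 `BSDpOnCellC` / crux 3 `MazurMCOnCellB` ∩ non-split; memo `HOME/cgshw-MEMO-24.md` §1 (d), §5)

HONEST FRAMING (cell `bsd-eis`, run/shared/lean/pub/bsd-eis/): pure commutative algebra of
`Λ = ℤ_p⟦T⟧`, everything PROVED (Mathlib + the tree's `X1.MuLambda` / `X2.KeyCongruence` /
`LcongrIffUnitCongruence` / `LcongrAtLevelOne` API); nothing booked; X2 stays CONSTRUCTION-SHAPED;
no label or count moves; BSD is proved for no curve.

## The point

On a Hida branch whose Λ-adic modular symbol lies in `𝔪_Λ·𝕎` (memo §1 (b)(iii): the 1020e1 and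
660c1 branches) the family delivers, for the depth-`m` member `g`, only `L_g = u·L_E + 3·M` with `u`
a unit and `M̄ := M mod 3` the mod-3 L-function of a SECOND mod-3 eigensymbol (`Ξ̄`; at 1020e1 the
symbol of the old curve 34a1, at 660c1 that of 110b1). Level one of `lcongr` is then free (§1), but
level two holds iff `M̄ ∈ (L̄_E)` in `𝔽_p⟦T⟧` (§2), in particular only if `ord_T M̄ ≥ ord_T L̄_E = λ(E)`
(§3): at 660c1 (`ord M̄ = 2 = λ(E)`) the depth-2 member satisfies `lcongr(2)`, at 1020e1
(`ord M̄ = 2 < 4 = λ(E)`: `E`'s line is «special») it does NOT — predicted from this lemma's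
statement and then observed numerically (memo §5). This is the kernel form of «one level is lost
when `E`'s mod-p symbol line is special».

## Contents

* §1 `lcongr_one_of_eq_unit_mul_add_C_mul` — `L = u·E + p·M`, `u` a unit ⟹ `(L) + (p) = (E) + (p)`.
* §2 `lcongr_two_iff_red_mem_span` — with `E ≠ 0`, `μ(E) = 0`: `(L) + (p)² = (E) + (p)² ⟺ red M ∈ (red E)`.
* §3 `order_red_le_of_lcongr_two` — the necessary condition `ord_T(red E) ≤ ord_T(red M)` (for
  `red M ≠ 0`), i.e. `lcongr(2)` fails whenever the first-order term has SMALLER `T`-order than `λ(E)`.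

What this is NOT: not a statement about any `L`-function or modular symbol; `u`, `M` and the
decomposition `L = u·E + p·M` are INPUTS (in the memo they come from the Λ-adic symbol, memo level).

References: [Skinner2016PacificMC] §3.1 (p. 192); [Washington1997] §7.1; [CastellaGrossiSkinner2025]
proof of Thm. 7.2.3 (key congruence).
-/

set_option autoImplicit false
set_option linter.dupNamespace false

noncomputable section

open Literature.NumberTheory.EllipticCurves Summit.BirchSwinnertonDyer.Rank1Residual.X1.MuLambda
  Summit.BirchSwinnertonDyer.Rank1Residual.X2.KeyCongruence
  Summit.BirchSwinnertonDyer.Rank1Residual.Supersingular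
  Summit.BirchSwinnertonDyer.BirchSwinnertonDyer.Theorems.LcongrIffUnitCongruence
  Summit.BirchSwinnertonDyer.BirchSwinnertonDyer.Theorems.LcongrAtLevelOne Summit.BirchSwinnertonDyer.Rank2

namespace Summit.BirchSwinnertonDyer.BirchSwinnertonDyer.Theorems.LcongrSecondLevel

variable {p : ℕ} [Fact p.Prime]

/-! ## §1. Level one is free -/

/-- **`lcongr` at level 1 from `L = u·E + p·M`.** If `u` is a unit of `Λ` then
`(L) + (p) = (E) + (p)`. [cite: Skinner2016PacificMC, §3.1 (p. 192)] -/
theorem lcongr_one_of_eq_unit_mul_add_C_mul {L E u M : IwasawaAlgebra p} (hu : IsUnit u)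
    (h : L = u * E + PowerSeries.C (p : ℤ_[p]) * M) :
    Ideal.span ({L} : Set (IwasawaAlgebra p)) ⊔
        (Ideal.span {(PowerSeries.C (p : ℤ_[p]) : IwasawaAlgebra p)}) ^ 1 =
      Ideal.span ({E} : Set (IwasawaAlgebra p)) ⊔
        (Ideal.span {(PowerSeries.C (p : ℤ_[p]) : IwasawaAlgebra p)}) ^ 1 :=
  lcongr_of_isUnit_of_eq_mul_add hu 1 (by rw [pow_one]; exact h)

/-! ## §2. Level two is decided by the first-order term mod `p` -/

/-- **The second level of `lcongr`.** Let `E ≠ 0` with `μ(E) = 0`, `u` a unit and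
`L = u·E + p·M` in `Λ = ℤ_p⟦T⟧`. Then `(L) + (p)² = (E) + (p)²` if and only if `red M ∈ (red E)` in
`𝔽_p⟦T⟧`. Proof: (⇒) by `KeyCongruence.exists_isUnit_and_sub_mul_mem_of_span_sup_eq` there is a
unit `w` with `L − E·w ∈ (p²)`; reducing `(u − w)·E = L − E·w − p·M` mod `p` and using that `𝔽_p⟦T⟧`
is a domain with `red E ≠ 0` gives `w = u − p·t`, whence `p·(t·E + M) ∈ (p²)`, `t·E + M ∈ (p)` and
`red M = −red t · red E`. (⇐) if `red M = c̄·red E`, lift `c̄` to `t`, put `w := u + p·t` (a unit);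
then `L − w·E = p·(M − t·E) ∈ (p²)` and `LcongrIffUnitCongruence` §1 applies.
[cite: Skinner2016PacificMC, §3.1 (p. 192)] [cite: Washington1997, §7.1] -/
theorem lcongr_two_iff_red_mem_span {L E u M : IwasawaAlgebra p} (hE : E ≠ 0) (hμ : mu E = 0)
    (hu : IsUnit u) (h : L = u * E + PowerSeries.C (p : ℤ_[p]) * M) :
    Ideal.span ({L} : Set (IwasawaAlgebra p)) ⊔
        (Ideal.span {(PowerSeries.C (p : ℤ_[p]) : IwasawaAlgebra p)}) ^ 2 =
      Ideal.span ({E} : Set (IwasawaAlgebra p)) ⊔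
        (Ideal.span {(PowerSeries.C (p : ℤ_[p]) : IwasawaAlgebra p)}) ^ 2 ↔
    red M ∈ Ideal.span ({red E} : Set (PowerSeries (IsLocalRing.ResidueField ℤ_[p]))) := by
  have hredE : red E ≠ 0 := red_ne_zero_of_mu_eq_zero hE hμ
  have hC2 : (PowerSeries.C ((p : ℤ_[p]) ^ 2) : IwasawaAlgebra p) =
      PowerSeries.C (p : ℤ_[p]) * PowerSeries.C (p : ℤ_[p]) := by
    rw [C_pow_eq, pow_two]
  constructor
  · intro hc
    have hm : mu E < 2 := by omega
    obtain ⟨w, hw, hmem⟩ := exists_isUnit_and_sub_mul_mem_of_span_sup_eq hE hm hc.symm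
    obtain ⟨s, hs⟩ := Ideal.mem_span_singleton'.mp hmem
    -- `(u - w) E = s C(p^2) - C p M`
    have h1 : (u - w) * E = PowerSeries.C (p : ℤ_[p]) * (s * PowerSeries.C (p : ℤ_[p]) - M) := by
      have e1 : s * (PowerSeries.C (p : ℤ_[p]) * PowerSeries.C (p : ℤ_[p])) = L - E * w := by
        rw [← hC2]; exact hs
      linear_combination -e1 - h
    have h2 : red ((u - w) * E) = 0 := by
      rw [red_eq_zero_iff, h1]
      exact dvd_mul_right _ _
    have h3 : red (u - w) = 0 := by
      have : red (u - w) * red E = 0 := by simpa [red, map_mul] using h2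
      exact (mul_eq_zero.mp this).resolve_right hredE
    obtain ⟨t, ht⟩ := (red_eq_zero_iff _).mp h3
    -- `C p * (t E + M - s C p) = 0`
    have h4 : PowerSeries.C (p : ℤ_[p]) * (t * E + M - s * PowerSeries.C (p : ℤ_[p])) = 0 := by
      have e2 : (u - w) * E = PowerSeries.C (p : ℤ_[p]) * t * E := by rw [ht]
      linear_combination h1 - e2
    have h5 : t * E + M - s * PowerSeries.C (p : ℤ_[p]) = 0 :=
      (mul_eq_zero.mp h4).resolve_left (IwasawaAlgebra.C_natCast_p_ne_zero p)
    have hM : M = s * PowerSeries.C (p : ℤ_[p]) + (-t) * E := by linear_combination h5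
    rw [hM]
    have hredC : red (s * PowerSeries.C (p : ℤ_[p])) = 0 := by
      rw [red_eq_zero_iff]; exact dvd_mul_left _ _
    have : red (s * PowerSeries.C (p : ℤ_[p]) + (-t) * E) = red (-t) * red E := by
      have hadd : red (s * PowerSeries.C (p : ℤ_[p]) + (-t) * E) =
          red (s * PowerSeries.C (p : ℤ_[p])) + red ((-t) * E) := by simp [red, map_add]
      rw [hadd, hredC, zero_add]; simp [red, map_mul]
    rw [this]
    exact Ideal.mem_span_singleton'.mpr ⟨red (-t), rfl⟩
  · intro hmem
    obtain ⟨cbar, hc⟩ := Ideal.mem_span_singleton'.mp hmem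
    obtain ⟨t, ht⟩ := red_surjective (p := p) cbar
    -- `M - t E ≡ 0 (mod p)`
    have hred0 : red (M - t * E) = 0 := by
      have : red (M - t * E) = red M - red t * red E := by simp [red, map_sub, map_mul]
      rw [this, ht, ← hc, sub_self]
    obtain ⟨c, hcc⟩ := (red_eq_zero_iff _).mp hred0
    -- the unit `w := u + p t`
    have hw : IsUnit (u + PowerSeries.C (p : ℤ_[p]) * t) := by
      obtain ⟨v, rfl⟩ := hu
      have hv : (↑v + PowerSeries.C (p : ℤ_[p]) * t : IwasawaAlgebra p) =
          ↑v * (1 - (-(↑v⁻¹ * PowerSeries.C (p : ℤ_[p]) * t))) := by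
        rw [sub_neg_eq_add, mul_add, mul_one, ← mul_assoc, ← mul_assoc, Units.mul_inv, one_mul]
      rw [hv]
      refine (Units.isUnit v).mul (isUnit_one_sub_of_C_p_dvd ?_)
      exact ⟨-(↑v⁻¹ * t), by ring⟩
    have hmem' : L - E * (u + PowerSeries.C (p : ℤ_[p]) * t) ∈
        Ideal.span ({PowerSeries.C ((p : ℤ_[p]) ^ 2)} : Set (IwasawaAlgebra p)) := by
      refine Ideal.mem_span_singleton'.mpr ⟨c, ?_⟩
      rw [hC2]
      have : L - E * (u + PowerSeries.C (p : ℤ_[p]) * t) =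
          PowerSeries.C (p : ℤ_[p]) * (M - t * E) := by rw [h]; ring
      rw [this, hcc]; ring
    exact (span_sup_span_C_pow_eq_of_isUnit_of_sub_mul_mem (a := E) (b := L) hw 2 hmem').symm

/-! ## §3. The `T`-order obstruction («E special ⟹ one level lost») -/

/-- **If `lcongr(2)` holds then the first-order term cannot have smaller `T`-order than `λ(E)`.**
With the hypotheses of §2 and `red M ≠ 0`: `(L) + (p)² = (E) + (p)²` implies
`order(red E) ≤ order(red M)` (and `order(red E) = λ(E)` by `Rank2.lam_eq_toNat_order_red_of_mu_eq_zero`).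
Contrapositive: `ord_T M̄ < λ(E)` ⟹ `lcongr(2)` FAILS for `L = u·E + p·M` — the 1020e1 case of the memo
(`ord M̄ = 2 < 4`). [cite: Washington1997, §7.1] -/
theorem order_red_le_of_lcongr_two {L E u M : IwasawaAlgebra p} (hE : E ≠ 0) (hμ : mu E = 0)
    (hu : IsUnit u) (h : L = u * E + PowerSeries.C (p : ℤ_[p]) * M)
    (hc : Ideal.span ({L} : Set (IwasawaAlgebra p)) ⊔
        (Ideal.span {(PowerSeries.C (p : ℤ_[p]) : IwasawaAlgebra p)}) ^ 2 =
      Ideal.span ({E} : Set (IwasawaAlgebra p)) ⊔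
        (Ideal.span {(PowerSeries.C (p : ℤ_[p]) : IwasawaAlgebra p)}) ^ 2) :
    (red E).order ≤ (red M).order := by
  obtain ⟨c, hcm⟩ := Ideal.mem_span_singleton'.mp ((lcongr_two_iff_red_mem_span hE hμ hu h).mp hc)
  rw [← hcm, mul_comm]
  exact le_trans le_self_add (PowerSeries.le_order_mul _ _)

/-- **λ-form of §3.** Under the same hypotheses, `lcongr(2)` forces `λ(E) ≤ ord_T(red M)` (as an
inequality in `ℕ∞`, `λ(E) = order(red E)` for `μ(E) = 0`). [cite: Washington1997, §7.1] -/
theorem lam_le_order_red_of_lcongr_two {L E u M : IwasawaAlgebra p} (hE : E ≠ 0) (hμ : mu E = 0)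
    (hu : IsUnit u) (h : L = u * E + PowerSeries.C (p : ℤ_[p]) * M)
    (hc : Ideal.span ({L} : Set (IwasawaAlgebra p)) ⊔
        (Ideal.span {(PowerSeries.C (p : ℤ_[p]) : IwasawaAlgebra p)}) ^ 2 =
      Ideal.span ({E} : Set (IwasawaAlgebra p)) ⊔
        (Ideal.span {(PowerSeries.C (p : ℤ_[p]) : IwasawaAlgebra p)}) ^ 2) :
    (lam E : ℕ∞) ≤ (red M).order := by
  have hle := order_red_le_of_lcongr_two hE hμ hu h hc
  have hredE : red E ≠ 0 := red_ne_zero_of_mu_eq_zero hE hμ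
  have hfin : (red E).order = ((red E).order.toNat : ℕ∞) :=
    (ENat.coe_toNat (PowerSeries.order_eq_top.not.mpr hredE)).symm
  rw [lam_eq_toNat_order_red_of_mu_eq_zero hμ, ← hfin]
  exact hle

end Summit.BirchSwinnertonDyer.BirchSwinnertonDyer.Theorems.LcongrSecondLevel

end
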